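import Summits.QuantumFields.YangMills.Theorems.ToronSmallBallSiteTwistSkew
import HarnessLib

/-!
# The time-independent covariant sheet translate of a whole chain, read from slice `0`, preserves the chain's a-priori measure

Support module for the translate cruxes of seat ym-idea-4's LINE g12-A/B (`ToronSmallBall.ToronCoreRaritySubQuartic` ⟨stmt-QuantumFields-23956⟩ case (α),
`OffCoreStripWindowDeep` ⟨23957⟩, `QuantileBitPurity.HolonomyQuantileSubQuartic` ⟨23948⟩; memo HOME `bc/g12-A/PLAN-X1-v2-gauss.md` §2: the translate element
`h(s)` is read COVARIANTLY from the slice-`0` configuration (local axis of a fat transverse holonomy — non-sheet links) and applied, time-independently, to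
EVERY slice of the chain, so that all time-like couplings stay exactly invariant (`timeCoupling_siteTwist_siteTwist`)).  We prove the measure half:

★ `measurePreserving_chain_siteTwist_of_indep` — if `hf : GaugeConfig 3 L G → (Site 3 L → G)` is measurable and independent of the sheet links, the chain map
`U⃗ ↦ (siteTwist k (hf U₀) U_t)_t` preserves `⊗_t configMeasure` (skew product over slice `0`: the slice-`0` map is `measurePreserving_siteTwist_of_indep`,
the other slices are translated by elements depending on slice `0` only, `measurePreserving_siteTwist_slices`).
Also `measurable_siteTwist_uncurry` (joint measurability of `(h, U) ↦ siteTwist k h U`).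

HONEST FRAMING: a change-of-variables lemma on a finite product of compact groups; nothing about infinite volume, the continuum limit or the Clay gap.
No `sorry`, no new axiom, no new definition.  References: [cite: Luscher1983, §2]; [cite: MontvayMunster1994, (3.145)].
-/

set_option autoImplicit false

noncomputable section

open MeasureTheory
open Literature.MathematicalPhysics.QuantumFieldTheory
open Literature.MathematicalPhysics.QuantumLattice

namespace Summit.QuantumFields.YangMills.Theorems.FemtoTransferGap

variable {G : Type*} [Group G] [MeasurableSpace G] [TopologicalSpace G] [IsTopologicalGroup G] [BorelSpace G] [CompactSpace G]
  [SecondCountableTopology G] {L : ℕ} [NeZero L]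

omit [CompactSpace G] [NeZero L] in
/-- Joint measurability of the site-dependent sheet translate in (elements, configuration). [folklore] -/
theorem measurable_siteTwist_uncurry (k : Fin 3) :
    Measurable (fun q : (Site 3 L → G) × GaugeConfig 3 L G => siteTwist k q.1 q.2) := by
  classical
  refine measurable_pi_lambda _ fun e => ?_
  by_cases he : e.2 = k ∧ e.1 k = 0
  · have h1 : Measurable fun q : (Site 3 L → G) × GaugeConfig 3 L G => q.1 e.1 := (measurable_pi_apply e.1).comp measurable_fst
    have h2 : Measurable fun q : (Site 3 L → G) × GaugeConfig 3 L G => q.2 e := (measurable_pi_apply e).comp measurable_snd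
    have e1 : (fun q : (Site 3 L → G) × GaugeConfig 3 L G => siteTwist k q.1 q.2 e) = fun q => q.1 e.1 * q.2 e := by
      funext q; rw [siteTwist_apply, if_pos he]
    rw [e1]; exact h1.mul h2
  · have e1 : (fun q : (Site 3 L → G) × GaugeConfig 3 L G => siteTwist k q.1 q.2 e) = fun q => q.2 e := by
      funext q; rw [siteTwist_apply, if_neg he]
    rw [e1]; exact (measurable_pi_apply e).comp measurable_snd

set_option maxHeartbeats 800000 in
/-- ★ **The chain translate read from slice `0` preserves the chain measure.**  Let `hf` be measurable and independent of the sheet links.  Then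
`U⃗ ↦ (t ↦ siteTwist k (hf U₀) U_t)` preserves `⊗_{t < n+1} configMeasure G L`: a skew product over slice `0` (`measurePreserving_siteTwist_of_indep` on the
base, slice-wise left translations by the base-dependent elements on the fibre). [cite: Luscher1983, §2] [cite: MontvayMunster1994, (3.145)] -/
theorem measurePreserving_chain_siteTwist_of_indep {n : ℕ} (k : Fin 3) {hf : GaugeConfig 3 L G → Site 3 L → G} (hm : Measurable hf)
    (hind : ∀ U V : GaugeConfig 3 L G, (∀ e : Edge 3 L, ¬ (e.2 = k ∧ e.1 k = 0) → U e = V e) → hf U = hf V) :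
    MeasurePreserving (fun (Us : Fin (n + 1) → GaugeConfig 3 L G) (t : Fin (n + 1)) => siteTwist k (hf (Us 0)) (Us t))
      (Measure.pi fun _ : Fin (n + 1) => configMeasure G L) (Measure.pi fun _ : Fin (n + 1) => configMeasure G L) := by
  classical
  let ψ : (Fin (n + 1) → GaugeConfig 3 L G) ≃ᵐ GaugeConfig 3 L G × (Fin n → GaugeConfig 3 L G) :=
    MeasurableEquiv.piFinSuccAbove (fun _ : Fin (n + 1) => GaugeConfig 3 L G) 0
  have hψ : MeasurePreserving ψ (Measure.pi fun _ : Fin (n + 1) => configMeasure G L)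
      ((configMeasure G L).prod (Measure.pi fun _ : Fin n => configMeasure G L)) :=
    measurePreserving_piFinSuccAbove (fun _ : Fin (n + 1) => configMeasure G L) 0
  -- base map and fibre maps
  let f : GaugeConfig 3 L G → GaugeConfig 3 L G := fun U => siteTwist k (hf U) U
  have hf0 : MeasurePreserving f (configMeasure G L) (configMeasure G L) := measurePreserving_siteTwist_of_indep k hm hind
  let g : GaugeConfig 3 L G → (Fin n → GaugeConfig 3 L G) → (Fin n → GaugeConfig 3 L G) := fun U rest j => siteTwist k (hf U) (rest j)
  have hgm : Measurable (Function.uncurry g) := by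
    refine measurable_pi_lambda _ fun j => ?_
    have h1 : Measurable fun q : GaugeConfig 3 L G × (Fin n → GaugeConfig 3 L G) => (hf q.1, q.2 j) :=
      (hm.comp measurable_fst).prodMk ((measurable_pi_apply j).comp measurable_snd)
    exact (measurable_siteTwist_uncurry k).comp h1
  have hg : ∀ U, Measure.map (g U) (Measure.pi fun _ : Fin n => configMeasure G L) = Measure.pi fun _ : Fin n => configMeasure G L := fun U =>
    (measurePreserving_siteTwist_slices (L := L) k (fun _ : Fin n => hf U)).map_eq
  have hΨ : MeasurePreserving (fun q : GaugeConfig 3 L G × (Fin n → GaugeConfig 3 L G) => (f q.1, g q.1 q.2))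
      ((configMeasure G L).prod (Measure.pi fun _ : Fin n => configMeasure G L))
      ((configMeasure G L).prod (Measure.pi fun _ : Fin n => configMeasure G L)) :=
    MeasurePreserving.skew_product hf0 hgm (Filter.Eventually.of_forall hg)
  -- the chain translate is the conjugate of the skew product by `ψ`
  have hT : (fun (Us : Fin (n + 1) → GaugeConfig 3 L G) (t : Fin (n + 1)) => siteTwist k (hf (Us 0)) (Us t)) =
      ψ.symm ∘ (fun q : GaugeConfig 3 L G × (Fin n → GaugeConfig 3 L G) => (f q.1, g q.1 q.2)) ∘ ψ := by
    funext Us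
    show (fun t : Fin (n + 1) => siteTwist k (hf (Us 0)) (Us t)) =
      Fin.insertNth 0 (f (Us 0)) (g (Us 0) (Fin.removeNth 0 Us))
    funext t
    refine Fin.cases ?_ (fun j => ?_) t
    · rw [Fin.insertNth_apply_same]
    · rw [← Fin.succAbove_zero, Fin.insertNth_apply_succAbove]
      rfl
  rw [hT]
  exact hψ.symm.comp (hΨ.comp hψ)

end Summit.QuantumFields.YangMills.Theorems.FemtoTransferGap

end
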